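import Literature.Claims.NS.GlimmPetrillo2026
import Literature.Analysis.FluidPDE.TorusClassicalLerayHopfProofs
import Literature.Analysis.FluidPDE.TorusNSVectorFieldHolder
import Summits.NavierStokesRegularity.NavierStokesRegularity.Theorems.SoloSalvageGlimmPetrillo2026

/-!
# D-0090 NS-CLAIMS, claim C07 `GlimmPetrillo2026` — kernel countermodels to typed steps

Cell `ns-claims`; refuter `ns-claims-refuter-3` (typist `ns-claims-typist-5`, referee `ns-claims-ref-2` /
`ns-claims-ref-4`, salvage `ns-claims-salvage-p5`). Every theorem here NEGATES a `def … : Prop` of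
`Literature.Claims.NS.GlimmPetrillo2026` (J. Glimm – J. Petrillo, arXiv:2410.09261 v10) by an explicit
witness; nothing is asserted about the Navier–Stokes system beyond the tree's own theorems.

THE WITNESS (one for all kills): the first Stokes shell of the unit torus `ℝ³/ℤ³`. The ABC datum
`w = abcFlow 1 1 1` is a non-zero, divergence-free, zero-mean, single-shell real trigonometric polynomial
(`IsFiniteModeDatum`, hence `IsAdmissibleDatum`), and `U(t) = e^{−4π²νt}·w`, `P(t) = −e^{−8π²νt}‖w‖²/2` is a
GLOBAL classical solution of the unforced Navier–Stokes system on `𝕋³ × [0,∞)` (tree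
`Torus.isClassicalNSSolutionOn_abcFlow`), hence a global Leray–Hopf weak solution
(`IsClassicalNSSolutionOn.isLerayHopfOn_of_convex`). Along it `‖U(s)‖₂ = √3·e^{−4π²νs}` and
`ν_t(s) = ν‖∇U(s)‖² = K·e^{−8π²νs}` (`nuT_eq_dissRate`, salvage-p5 p467372), and `4π²ν > 4ν/3 > ν/2`.

* `not_Step_3` — **first failing step: the FLOOR, §1.5 l.248–252 / Fact 1 l.263–268 / Thm 5.1 proof
  l.1232–1240** («the SRI O(e^{−νt/2}) decay rate is exact. It is not an upper bound»): no `c > 0` has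
  `c·e^{−νs/2} ≤ ‖U(s)‖₂` on every interval of regularity, since `U` is regular on every `[0,T)` and decays
  at the faster rate `4π²ν`. Class: false lemma (countermodel). `not_Step_3alt`: the same under reading R2
  (floor under `ν‖∇v‖²`, rate `8π²ν`).
* `not_Step_5` — Thm 3.1 (c) l.986–991 under reading R1 (`‖v(s)‖₂ ≤ ν_t(s)`): along `U`,
  `ν_t = K e^{−8π²νs}` drops below `√3 e^{−4π²νs}` for large `s` (downstream; amplitude/rate-variant).
* `not_FiniteHorizon`, `not_ClaimedTheoremClassical_natural`, `not_ClaimedTheorem_natural` — the glue's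
  target and the headline Thm 5.1 l.1204–1207 in the checkable reading `Notions.natural` (no selection,
  «turbulent» = non-zero): the global classical (= global Leray–Hopf, globally regular) solution `U` from
  the turbulent finite-mode datum `w`.
* `not_Thm31cProofInference` — the printed inference of the proof of Thm 3.1 (c), l.1020–1023
  (`x = y + z`, `y ≥ 0`, `y ≠ 0`, `z > 0` ⟹ `x < y`): `2 = 1 + 1`.
* `not_RateRuleD1` — the rate rule D1 l.248–249 in the abstract form typed («`∫₀^∞|g|^p < ∞` ⟹
  `g = O(e^{−νt/p})`»): `g(t) = (1+t²)⁻¹`, `p = 1`.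

Not attacked: `Step_4` (ceiling on `ν_t = ν‖∇v‖²` along arbitrary regularity intervals = enstrophy
control; true on eigenmodes), `Step_1`/`Step_2`/`Step_5alt`/`Step_6` (kernel-discharged by salvage-p5,
`SoloSalvageGlimmPetrillo2026`), `Lemma31` (energy EQUALITY for all Leray–Hopf solutions on 𝕋³ — open),
`Theorem41`, `Theorem71`.

Closed terms; axioms propext, Classical.choice, Quot.sound.

WHAT THIS IS NOT: not a claim about NS regularity or blow-up; not a claim about any author beyond the typed
locator.
-/

-- The summit's canonical theorem namespace repeats the summit name (single-conjunct summit).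
set_option linter.dupNamespace false

noncomputable section

open MeasureTheory Set Filter Function
open scoped ENNReal Topology RealInnerProductSpace

namespace Summit.NavierStokesRegularity.NavierStokesRegularity.Theorems.GlimmPetrillo2026

open Literature.Claims.NS.GlimmPetrillo2026 Literature.Analysis Literature.Analysis.FluidPDE
  Literature.Analysis.FunctionSpaces

/-! ### The witness: the first Stokes shell -/

/-- The datum: the ABC flow with `A = B = C = 1`. [folklore] -/
abbrev w : UnitAddTorus (Fin 3) → EuclideanSpace ℝ (Fin 3) := Torus.abcFlow 1 1 1

/-- The decay rate of the first Stokes shell of the unit torus, `4π²ν`. [folklore] -/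
abbrev rate (ν : ℝ) : ℝ := ν * (2 * Real.pi) ^ 2

/-- The global classical solution through `w`: `U(t) = e^{−4π²νt}·w`. [folklore] -/
abbrev U (ν : ℝ) : ℝ → UnitAddTorus (Fin 3) → EuclideanSpace ℝ (Fin 3) :=
  fun t x => Real.exp (-(ν * (2 * Real.pi) ^ 2) * t) • Torus.abcFlow 1 1 1 x

/-- Its pressure `−e^{−8π²νt}‖w‖²/2`. [folklore] -/
abbrev P (ν : ℝ) : ℝ → UnitAddTorus (Fin 3) → ℝ :=
  fun t x => (-(Real.exp (-(ν * (2 * Real.pi) ^ 2) * t) ^ 2)) * (‖Torus.abcFlow 1 1 1 x‖ ^ 2 / 2)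

/-- `(U, P)` is a classical solution of the unforced Navier–Stokes system on `𝕋³ × [0, ∞)` (tree,
Beltrami/ABC flows). [folklore] -/
theorem isClassical (ν : ℝ) : Torus.IsClassicalNSSolutionOn (Ici 0) ν 0 (U ν) (P ν) :=
  Torus.isClassicalNSSolutionOn_abcFlow ν 1 1 1

/-- … hence on every `[0, T)`. [folklore] -/
theorem isClassical_Ico (ν T : ℝ) : Torus.IsClassicalNSSolutionOn (Ico 0 T) ν 0 (U ν) (P ν) :=
  (isClassical ν).mono Ico_subset_Ici_self (uniqueDiffOn_Ico 0 T)

/-- `U(0) = w`. [folklore] -/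
theorem U_zero (ν : ℝ) : U ν 0 = w := by
  funext x; simp [U]

/-- The datum is a non-zero divergence-free zero-mean finite-mode field. [folklore] -/
theorem w_finiteMode : IsFiniteModeDatum w :=
  ⟨⟨_, _, Torus.abcFlow_eq_realTrigPoly 1 1 1⟩, Torus.isDivFree_abcFlow 1 1 1,
    Torus.hasZeroMean_abcFlow 1 1 1⟩

/-- The datum is admissible (smooth, divergence free, zero mean). [folklore] -/
theorem w_admissible : IsAdmissibleDatum w := w_finiteMode.isAdmissibleDatum

/-- `∫‖w‖² = 3`. [folklore] -/
theorem w_energy : ∫ x, ‖w x‖ ^ 2 = 3 := by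
  have := Torus.integral_norm_sq_abcFlow 1 1 1
  norm_num at this
  simpa using this

/-- `w ≠ 0`. [folklore] -/
theorem w_ne_zero : w ≠ 0 := by
  intro h
  have hint := w_energy
  rw [h] at hint
  norm_num at hint

/-- `U` is a global Leray–Hopf weak solution from `w`. [folklore] -/
theorem isGlobalLerayHopf (ν : ℝ) : Torus.IsGlobalLerayHopf ν 0 w (U ν) := by
  intro T hT
  have h := (isClassical ν).isLerayHopfOn_of_convex (convex_Ici 0) hT (fun t ht => mem_Ici.2 ht.1)
  rwa [U_zero] at h

/-- `U` is globally regular from `w` (it is its own classical representative). [folklore] -/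
theorem isGloballyRegular (ν : ℝ) : IsGloballyRegular ν w (U ν) :=
  ⟨U ν, P ν, isClassical ν, U_zero ν, fun _ _ => Filter.EventuallyEq.rfl⟩

/-! ### Exact decay along the witness -/

/-- Pointwise decay `‖U(t,x)‖ = e^{−4π²νt}‖w(x)‖`. [folklore] -/
theorem norm_U (ν t : ℝ) (x : UnitAddTorus (Fin 3)) :
    ‖U ν t x‖ = Real.exp (-(rate ν) * t) * ‖w x‖ := by
  simp [U, norm_smul, Real.abs_exp]

/-- `‖U(s)‖₂ = √3 · e^{−4π²νs}`. [folklore] -/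
theorem solNorm_U (ν s : ℝ) : solNorm (U ν) s = Real.sqrt 3 * Real.exp (-(rate ν) * s) := by
  unfold solNorm
  simp_rw [norm_U, mul_pow]
  rw [integral_const_mul, w_energy, Real.sqrt_mul (sq_nonneg _), Real.sqrt_sq (Real.exp_pos _).le,
    mul_comm]

/-- `ν‖∇U(s)‖² = ν‖∇w‖² · e^{−8π²νs}`. [folklore] -/
theorem dissRate_U (ν s : ℝ) :
    dissRate ν (U ν) s = ν * Torus.gradNormSq w * Real.exp (-(2 * rate ν) * s) := by
  unfold dissRate
  have h : U ν s = fun x => Real.exp (-(rate ν) * s) • w x := rfl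
  rw [h, Torus.gradNormSq_fun_const_smul (Torus.isSmooth_abcFlow 1 1 1)]
  have he : Real.exp (-(rate ν) * s) ^ 2 = Real.exp (-(2 * rate ν) * s) := by
    rw [sq, ← Real.exp_add]; ring_nf
  rw [he]; ring

/-! ### Decay-rate arithmetic -/

/-- A curve `K e^{−a t}` lies strictly below `c e^{−b t}` from some time on, whenever `b < a` and
`c > 0` (whatever `K`). [folklore] -/
theorem eventually_lt_of_rate_lt {a b c : ℝ} (K : ℝ) (hab : b < a) (hc : 0 < c) :
    ∃ t₀ : ℝ, 0 ≤ t₀ ∧ ∀ t, t₀ ≤ t → K * Real.exp (-a * t) < c * Real.exp (-b * t) := by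
  -- `K e^{-a t} < c e^{-b t}` iff `K < c e^{(a-b) t}`, and `e^{(a-b)t} ≥ 1 + (a-b) t`.
  refine ⟨max 0 ((|K| / c + 1) / (a - b)), le_max_left _ _, fun t ht => ?_⟩
  have hab' : 0 < a - b := sub_pos.2 hab
  have ht0 : 0 ≤ t := le_trans (le_max_left _ _) ht
  have ht1 : (|K| / c + 1) / (a - b) ≤ t := le_trans (le_max_right _ _) ht
  have h1 : |K| / c + 1 ≤ (a - b) * t := by
    have := mul_le_mul_of_nonneg_left ht1 hab'.le
    rwa [mul_div_cancel₀ _ hab'.ne'] at this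
  have h2 : 1 + (a - b) * t ≤ Real.exp ((a - b) * t) := Real.add_one_le_exp _ |>.trans_eq' (by ring)
  have h3 : |K| / c < Real.exp ((a - b) * t) := by linarith
  have h4 : |K| < c * Real.exp ((a - b) * t) := by
    rw [div_lt_iff₀ hc] at h3; linarith [mul_comm (Real.exp ((a - b) * t)) c]
  have hK : K ≤ |K| := le_abs_self K
  have hea : 0 < Real.exp (-a * t) := Real.exp_pos _
  calc K * Real.exp (-a * t) ≤ |K| * Real.exp (-a * t) := by
        exact mul_le_mul_of_nonneg_right hK hea.le
    _ < c * Real.exp ((a - b) * t) * Real.exp (-a * t) := mul_lt_mul_of_pos_right h4 hea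
    _ = c * Real.exp (-b * t) := by rw [mul_assoc, ← Real.exp_add]; ring_nf

/-- No floor `c e^{−b t} ≤ K e^{−a t}` for all `t ≥ 0` when `b < a`, `c > 0`. [folklore] -/
theorem not_floor_of_rate_lt {a b c : ℝ} (K : ℝ) (hab : b < a) (hc : 0 < c) :
    ¬ ∀ t : ℝ, 0 ≤ t → c * Real.exp (-b * t) ≤ K * Real.exp (-a * t) := by
  intro h
  obtain ⟨t₀, ht₀, H⟩ := eventually_lt_of_rate_lt K hab hc
  exact absurd (h t₀ ht₀) (not_le.2 (H t₀ le_rfl))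

/-- `ν/2 < 4π²ν` for `ν > 0`. [folklore] -/
theorem half_lt_rate {ν : ℝ} (hν : 0 < ν) : ν / 2 < rate ν := by
  have hπ : 3 < Real.pi := Real.pi_gt_three
  have h1 : (36 : ℝ) < (2 * Real.pi) ^ 2 := by nlinarith
  have h2 : ν * 36 < ν * (2 * Real.pi) ^ 2 := mul_lt_mul_of_pos_left h1 hν
  show ν / 2 < ν * (2 * Real.pi) ^ 2
  linarith

/-- `0 < 4π²ν`. [folklore] -/
theorem rate_pos {ν : ℝ} (hν : 0 < ν) : 0 < rate ν := by
  have := half_lt_rate hν; linarith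

/-! ### Step 3 (the floor) is false — both readings -/

/-- **C07, first failing step: `Step_3` (the floor / rate rule §1.5 l.248–252, Fact 1 l.263–268,
consumed at Thm 5.1 proof l.1232–1240) is false.** Witness `ν = 1`, `u₀ = abcFlow 1 1 1`, the global
classical solution `U(t) = e^{−4π²t}u₀` restricted to `[0,T)`, `T = s + 1`: `‖U(s)‖₂ = √3 e^{−4π²s}`
cannot stay above `c e^{−s/2}`, `c > 0`. [cite: GlimmPetrillo2026, §1.5 l.248–252; Thm 5.1 proof
l.1232–1240] -/
theorem not_Step_3 : ¬ Literature.Claims.NS.GlimmPetrillo2026.Step_3 := by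
  intro h
  obtain ⟨c, hc, H⟩ := h 1 one_pos w w_admissible w_ne_zero
  refine not_floor_of_rate_lt (Real.sqrt 3) (half_lt_rate one_pos) hc fun s hs => ?_
  have := H (s + 1) (U 1) (P 1) (isClassical_Ico 1 (s + 1)) (U_zero 1) s ⟨hs, by linarith⟩
  rw [solNorm_U] at this
  linarith [mul_comm (Real.sqrt 3) (Real.exp (-(rate 1) * s))]

/-- **`Step_3alt` (the floor under reading R2, `c e^{−νs/2} ≤ ν‖∇v(s)‖²`) is false**: along `U`,
`ν‖∇U(s)‖² = ν‖∇u₀‖² e^{−8π²νs}`. [cite: GlimmPetrillo2026, §1.5 l.248–252; Thm 5.1 proof l.1232–1240] -/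
theorem not_Step_3alt : ¬ Step_3alt := by
  intro h
  obtain ⟨c, hc, H⟩ := h 1 one_pos w w_admissible w_ne_zero
  have h2 : (1 : ℝ) / 2 < 2 * rate 1 := by
    have := half_lt_rate one_pos; have := rate_pos one_pos; linarith
  refine not_floor_of_rate_lt (1 * Torus.gradNormSq w) h2 hc fun s hs => ?_
  have := H (s + 1) (U 1) (P 1) (isClassical_Ico 1 (s + 1)) (U_zero 1) s ⟨hs, by linarith⟩
  rwa [dissRate_U] at this

/-! ### Step 5 (domination, reading R1) is false -/

/-- **`Step_5` (Thm 3.1 (c) l.986–991 read as `‖v(s)‖₂ ≤ ν_t(s)`) is false**: along `U` (with `ν = 1`)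
`ν_t(s) = ‖∇u₀‖² e^{−8π²s}` (`nuT_eq_dissRate`) falls below `‖U(s)‖₂ = √3 e^{−4π²s}` for large `s`.
[cite: GlimmPetrillo2026, Thm 3.1(c) l.986–991; Thm 5.1 proof l.1230] -/
theorem not_Step_5 : ¬ Literature.Claims.NS.GlimmPetrillo2026.Step_5 := by
  intro h
  have hlt : rate 1 < 2 * rate 1 := by have := rate_pos one_pos; linarith
  have hc : 0 < Real.sqrt 3 := Real.sqrt_pos.2 (by norm_num)
  refine not_floor_of_rate_lt (1 * Torus.gradNormSq w) hlt hc fun s hs => ?_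
  have hs' : s ∈ Ico 0 (s + 1) := ⟨hs, by linarith⟩
  have := (h 1 one_pos w w_admissible (s + 1) (U 1) (P 1) (isClassical_Ico 1 (s + 1)) (U_zero 1)
    s hs').2
  rwa [nuT_eq_dissRate (isClassical_Ico 1 (s + 1)) hs', dissRate_U, solNorm_U] at this

/-! ### The glue's target and the headline (natural reading) are false -/

/-- **`FiniteHorizon` (the conclusion the Steps 3–5 sandwich feeds, l.1241–1243 «T* < ∞») is false**:
`U` is classical on `[0, T* + 1)`. [cite: GlimmPetrillo2026, Thm 5.1 proof l.1241–1243] -/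
theorem not_FiniteHorizon : ¬ FiniteHorizon := by
  intro h
  obtain ⟨Tstar, -, H⟩ := h 1 one_pos w w_admissible w_ne_zero
  have := H (Tstar + 1) (U 1) (P 1) (isClassical_Ico 1 (Tstar + 1)) (U_zero 1)
  linarith

/-- **Thm 5.1 (l.1204–1216), classical-level reading, in the checkable reading `Notions.natural`
(«turbulent» = non-zero) is false**: the non-zero finite-mode datum `abcFlow 1 1 1` has the global
classical solution `U`. [cite: GlimmPetrillo2026, Thm 5.1 l.1204–1216] -/
theorem not_ClaimedTheoremClassical_natural : ¬ ClaimedTheoremClassical Notions.natural := by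
  intro h
  exact (h 1 one_pos w w_finiteMode w_ne_zero w_ne_zero).2 ⟨U 1, P 1, isClassical 1, U_zero 1⟩

/-- **Thm 5.1 (l.1204–1207), Leray–Hopf-level reading, in the checkable reading `Notions.natural`
(no selection, «turbulent» = non-zero) is false**: `U` is a global Leray–Hopf weak solution from the
non-zero finite-mode datum `abcFlow 1 1 1` and is globally regular. [cite: GlimmPetrillo2026, Thm 5.1
l.1204–1207] -/
theorem not_ClaimedTheorem_natural : ¬ ClaimedTheorem Notions.natural := by
  intro h
  exact (h 1 one_pos w w_finiteMode w_ne_zero w_ne_zero (U 1) (isGlobalLerayHopf 1) trivial).2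
    (isGloballyRegular 1)

/-! ### Two printed inferences (support declarations) are false -/

/-- **The inference printed as the proof of Thm 3.1 (c), l.1020–1023, is false**: `2 = 1 + 1` with
`1 ≥ 0`, `1 ≠ 0`, `1 > 0`, and `¬ 2 < 1`. [cite: GlimmPetrillo2026, Thm 3.1(c) proof l.1017–1024] -/
theorem not_Thm31cProofInference : ¬ Thm31cProofInference := by
  intro h
  have := h 2 1 1 zero_le_one one_ne_zero one_pos (by norm_num)
  norm_num at this

/-- **The rate rule D1 (§1.5 l.248–249) in the abstract form typed is false**: `g(t) = (1 + t²)⁻¹` has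
`∫₀^∞ |g| < ∞` (`p = 1`) but is not `O(e^{−t})` (`ν = 1`): `e^{t} ≥ t³/6 > C(1+t²)` for `t > 12|C|`,
`t ≥ 1`. [cite: GlimmPetrillo2026, §1.5 l.248–252] -/
theorem not_RateRuleD1 : ¬ RateRuleD1 := by
  intro h
  have hint : IntegrableOn (fun t : ℝ => |(1 + t ^ 2)⁻¹| ^ (1 : ℝ)) (Ioi 0) := by
    have h1 : (fun t : ℝ => |(1 + t ^ 2)⁻¹| ^ (1 : ℝ)) = fun t => (1 + t ^ 2)⁻¹ := by
      funext t
      rw [Real.rpow_one, abs_of_pos (by positivity)]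
    rw [h1]
    exact integrable_inv_one_add_sq.integrableOn
  obtain ⟨C, hC⟩ := h 1 one_pos 1 one_pos (fun t => (1 + t ^ 2)⁻¹) hint
  set t : ℝ := 12 * |C| + 1 with ht
  have ht1 : 1 ≤ t := by have := abs_nonneg C; linarith
  have ht0 : 0 ≤ t := by linarith
  have hCt := hC t ht0
  rw [abs_of_pos (by positivity), show -((1 : ℝ) / 1) * t = -t by ring] at hCt
  -- `e^{t} ≥ t³/6`
  have hexp : t ^ 3 / 6 ≤ Real.exp t := by
    have := Real.pow_div_factorial_le_exp (x := t) ht0 (n := 3)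
    norm_num [Nat.factorial] at this
    exact this
  -- from the claimed bound: `1 ≤ C (1+t²) e^{-t}`, i.e. `e^{t} ≤ C (1 + t²)`
  have hpos : 0 < 1 + t ^ 2 := by positivity
  have hle : Real.exp t ≤ C * (1 + t ^ 2) := by
    have h1 : 1 ≤ C * Real.exp (-t) * (1 + t ^ 2) := by
      have := mul_le_mul_of_nonneg_right hCt hpos.le
      rwa [inv_mul_cancel₀ hpos.ne'] at this
    have h2 : Real.exp t * 1 ≤ Real.exp t * (C * Real.exp (-t) * (1 + t ^ 2)) :=
      mul_le_mul_of_nonneg_left h1 (Real.exp_pos t).le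
    have h3 : Real.exp t * (C * Real.exp (-t) * (1 + t ^ 2)) = C * (1 + t ^ 2) := by
      have : Real.exp t * Real.exp (-t) = 1 := by rw [← Real.exp_add]; simp
      calc Real.exp t * (C * Real.exp (-t) * (1 + t ^ 2))
          = (Real.exp t * Real.exp (-t)) * (C * (1 + t ^ 2)) := by ring
        _ = C * (1 + t ^ 2) := by rw [this, one_mul]
    linarith [h2, h3]
  have hCabs : C * (1 + t ^ 2) ≤ |C| * (2 * t ^ 2) := by
    calc C * (1 + t ^ 2) ≤ |C| * (1 + t ^ 2) := mul_le_mul_of_nonneg_right (le_abs_self C) hpos.le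
      _ ≤ |C| * (2 * t ^ 2) := by
          apply mul_le_mul_of_nonneg_left _ (abs_nonneg C); nlinarith
  -- `t³/6 ≤ 2|C| t²` contradicts `t > 12|C|`
  have hfin : t ^ 3 / 6 ≤ |C| * (2 * t ^ 2) := hexp.trans (hle.trans hCabs)
  have htpos : 0 < t ^ 2 := by positivity
  have : t ≤ 12 * |C| := by
    by_contra hcon
    rw [not_le] at hcon
    have : |C| * (2 * t ^ 2) < t ^ 3 / 6 := by
      have h12 : 12 * |C| * t ^ 2 < t * t ^ 2 := mul_lt_mul_of_pos_right hcon htpos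
      nlinarith
    linarith
  linarith

end Summit.NavierStokesRegularity.NavierStokesRegularity.Theorems.GlimmPetrillo2026

end
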